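import Mathlib
import Summits.Ventures.FusionMHD.Models.CerfonFreidbergIterLikeQHalfMercLink
import HarnessLib

/-!
# Ventures/FusionMHD — Models/CerfonFreidbergIterLikeQHalfMercPanel.lean: the PER-PANEL LINK THEOREM `merc_panel_bracket` — from the kernel certificates of one
# `θ`-panel to the brackets of the FOUR F-independent Mercier registers of the TRUE surface `ψ_N = 1/2` of THE Cerfon–Freidberg ITER-like flux over that panel

HONEST FRAMING (LADDER-GRIDFUSION three columns; CF rung, F2 item R2; «F2.R2-CF-MERCIER-IMPLICIT» step (4) of `pub/gridfusion/models/F2-SCOPING.md` v1.6 §10(c)).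
For a panel `j` whose records `d : PanelCert`, `b : BoxData`, `ℓ : LinkData` (★ #117, model-5 g7) pass `d.ok`, `b.ok`, `ℓ.check d b`, `levelCheck ℓ d b` (model-7 g5),
whose Mercier certificate `mc : MercCert` (model-7 g7, `…QHalfMercPanels1–19`) passes `mc.ok`, and whose link constants `ml : MercLink` pass `ml.check`:
**`merc_panel_bracket`** — on `Θ_j = [π·2jh, π·(2j+2)h]`, for each of the kernels `KW = volKernelDs/D`, `KS = invGradKernel`, `KR = R²volKernel/G`,
`KB = volKernel/(R²G)`: `Lo ≤ ∫_{Θ_j} K(θ, ρ θ) dθ ≤ Hi` for the TRUE ray radius `ρ`, with integrability (the generic `tube_link` of `…QHalfMercLink` fed with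
`levelPanel_of_check`, `stripFacts_of_check`, model-7's register identities `gWA_eq …`, the tube envelopes `envW_bound …` of `…QHalfMercEnvelope`, the
third-derivative boxes `f3ok_all` (F2-Lipschitz) and the per-panel `∂_s G` boxes `gsokP` (G-Lipschitz), and the floor `G ≥ D_r² ≥ μ²`).
CERTIFIED: kernel (this file + imports, axioms standard).  VALIDATED: nothing used.  MODELLED: analytic Cerfon–Freidberg family; registers of a MODEL surface —
nothing about a device or stability.  No `decide`; `maxHeartbeats` raised for the one long proof.  Typer/prover: gridfusion-model-7 (g7), 2026-08-28.
Citations: Jardin 2010 §8.5 (8.134) [Jardin2010]; Freidberg 2014 §6.6.1 (6.153) [Freidberg2014].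
-/

noncomputable section

open Set MeasureTheory intervalIntegral Filter Topology NonemptyInterval
open Literature.Analysis.ODE Literature.Analysis.ODE.FExpr
open Literature.Analysis.ValidatedNumerics Literature.Analysis.ValidatedNumerics.PolyMP
open Literature.Analysis.ValidatedNumerics.NumericsMP Literature.Analysis.ValidatedNumerics.ExpPoly
open Literature.Analysis.ValidatedNumerics.ITaylor
open Literature.MathematicalPhysics.MHD Literature.MathematicalPhysics.MHD.CerfonFreidberg
open Summit.Ventures.FusionMHD.Models.PolarRay
open Summit.Ventures.FusionMHD.Models.CFIterLike.PolarPanel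

set_option autoImplicit false

namespace Summit.Ventures.FusionMHD.Models.CFIterLike.QHalf

/-- **Joint continuity of `Gfield`** on `[a, b] × [s₁, s₂]` with `0 < s₁`, `s₂ < 1` (the code list `GS` is `C^∞` on its domain `X > 0`, `s ≠ 0`). -/
theorem continuousOn_Gfield_box' {a b s₁ s₂ : ℝ} (h₁ : 0 < s₁) (h₂ : s₂ < 1) :
    ContinuousOn (fun p : ℝ × ℝ => Gfield p.1 p.2) (Icc a b ×ˢ Icc s₁ s₂) := by
  have hg : ContinuousOn (fun p : ℝ × ℝ => GS.eval (pt p.1 p.2)) (Icc a b ×ˢ Icc s₁ s₂) := by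
    refine (contDiffOn_eval GS).continuousOn.comp continuous_pt.continuousOn ?_
    intro p hp
    obtain ⟨e7, e9, e10⟩ := pt_coords p.1 p.2
    show GS.dom (pt p.1 p.2)
    exact (GS_dom (by rw [e7, e9, e10]; exact X_pos_of_box h₁.le h₂ hp.2) (by rw [e10]; exact (h₁.trans_le hp.2.1).ne')).1
  refine hg.congr fun p hp => ?_
  show Gfield p.1 p.2 = GS.eval (pt p.1 p.2)
  rw [GS_eval_eq (h₁.trans_le hp.2.1).ne']

/-- A panel-integral bracket with integrability, for a kernel `K` along the true ray radius `ρ`. -/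
def Bracket (K : ℝ → ℝ → ℝ) (a a' Lo Hi : ℝ) : Prop :=
  Lo ≤ ∫ θ in a..a', K θ (ρ θ) ∧ ∫ θ in a..a', K θ (ρ θ) ≤ Hi ∧ IntervalIntegrable (fun θ => K θ (ρ θ)) volume a a'

section panel

variable {d : PanelCert} {b : BoxData} {ℓ : LinkData} {mc : QHalfMerc.MercCert} {ml : MercLink}

set_option maxHeartbeats 8000000 in
/-- **THE PER-PANEL MERCIER LINK.**  See the module docstring. -/
theorem merc_panel_bracket (hd : d.ok = true) (hb : b.ok = true) (hℓ : ℓ.check d b = true) (hlev : levelCheck ℓ d b = true)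
    (hmc : mc.ok = true) (hml : ml.check ℓ d b mc = true) :
    Bracket KW (Real.pi * ((panelLeft hw d.j : ℚ) : ℝ)) (Real.pi * ((panelLeft hw (d.j + 1) : ℚ) : ℝ)) ((ml.WLo : ℚ) : ℝ) ((ml.WHi : ℚ) : ℝ)
    ∧ Bracket KS (Real.pi * ((panelLeft hw d.j : ℚ) : ℝ)) (Real.pi * ((panelLeft hw (d.j + 1) : ℚ) : ℝ)) ((ml.SLo : ℚ) : ℝ) ((ml.SHi : ℚ) : ℝ)
    ∧ Bracket KR (Real.pi * ((panelLeft hw d.j : ℚ) : ℝ)) (Real.pi * ((panelLeft hw (d.j + 1) : ℚ) : ℝ)) ((ml.RLo : ℚ) : ℝ) ((ml.RHi : ℚ) : ℝ)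
    ∧ Bracket KB (Real.pi * ((panelLeft hw d.j : ℚ) : ℝ)) (Real.pi * ((panelLeft hw (d.j + 1) : ℚ) : ℝ)) ((ml.BLo : ℚ) : ℝ) ((ml.BHi : ℚ) : ℝ) := by
  set a : ℝ := Real.pi * ((panelLeft hw d.j : ℚ) : ℝ) with ha_def
  set a' : ℝ := Real.pi * ((panelLeft hw (d.j + 1) : ℚ) : ℝ) with ha'_def
  have P := levelPanel_of_check hd hb hℓ hlev
  have SF := stripFacts_of_check hd hb hℓ
  -- unpack the rational side conditions
  simp only [MercLink.check, Bool.and_eq_true, decide_eq_true_eq] at hml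
  obtain ⟨⟨⟨⟨⟨⟨⟨⟨⟨⟨⟨⟨⟨⟨⟨⟨⟨⟨⟨⟨⟨⟨⟨⟨⟨⟨⟨⟨⟨⟨⟨⟨⟨cmj, cmlj⟩, cg⟩, cj32⟩, cBtlo⟩, cBthi⟩, cBslo0⟩, cBshi1⟩, cBslo⟩, cBshi⟩, cCtlo⟩, cCthi⟩, cCslo0⟩, cCshi1⟩, cCslo⟩, cCshi⟩, cμ⟩, cXlo⟩, cEW0⟩, cES0⟩, cER0⟩, cEB0⟩, cEW⟩, cES⟩, cER⟩, cEB⟩, cWLo⟩, cWHi⟩, cSLo⟩, cSHi⟩, cRLo⟩, cRHi⟩, cBLo⟩, cBHi⟩ := hml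
  have hboxF := f3ok_all ml.g cg
  have hboxG := gsokP cj32
  -- constants
  have hS : (0 : ℝ) < ((tmS : ℕ) : ℝ) := by exact_mod_cast tmS_pos
  have hpi := Real.pi_pos
  have hpiLo : ((piLoQ : ℚ) : ℝ) < Real.pi := by have := Real.pi_gt_d20; norm_num [piLoQ] at this ⊢; exact this
  have hpiHi : Real.pi < ((piHiQ : ℚ) : ℝ) := by have := Real.pi_lt_d20; norm_num [piHiQ] at this ⊢; exact this
  have hXaLo : ((XaLoQ : ℚ) : ℝ) ≤ Xa := by have := Xa_bounds.1; norm_num [XaLoQ] at this ⊢; exact this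
  have hXaHi : Xa ≤ ((XaHiQ : ℚ) : ℝ) := by have := Xa_bounds.2; norm_num [XaHiQ] at this ⊢; exact this
  have hXa0 : 0 < Xa := by linarith [Xa_bounds.1]
  -- θ ∈ [a, a'] lies in a box's θ-range whenever the box's θ-range contains [π⁻·2jh, π⁺·(2j+2)h]
  have hpl0 : (0 : ℚ) ≤ panelLeft hw d.j := by unfold panelLeft hw; positivity
  have θrange : ∀ lo hi : ℚ, lo ≤ piLoQ * panelLeft hw d.j → piHiQ * panelLeft hw (d.j + 1) ≤ hi →
      ∀ θ ∈ Icc a a', ((lo : ℚ) : ℝ) ≤ θ ∧ θ ≤ ((hi : ℚ) : ℝ) := by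
    intro lo hi clo chi θ hθ
    have h1 : ((lo : ℚ) : ℝ) ≤ a := by
      have : ((lo : ℚ) : ℝ) ≤ ((piLoQ : ℚ) : ℝ) * ((panelLeft hw d.j : ℚ) : ℝ) := by exact_mod_cast clo
      have h2 : ((piLoQ : ℚ) : ℝ) * ((panelLeft hw d.j : ℚ) : ℝ) ≤ a := mul_le_mul_of_nonneg_right hpiLo.le (by exact_mod_cast hpl0)
      linarith
    have h2 : a' ≤ ((hi : ℚ) : ℝ) := by
      have : ((piHiQ : ℚ) : ℝ) * ((panelLeft hw (d.j + 1) : ℚ) : ℝ) ≤ ((hi : ℚ) : ℝ) := by exact_mod_cast chi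
      have hpl1 : (0 : ℝ) ≤ ((panelLeft hw (d.j + 1) : ℚ) : ℝ) := by
        exact_mod_cast (show (0 : ℚ) ≤ panelLeft hw (d.j + 1) by unfold panelLeft hw; positivity)
      have h3 : a' ≤ ((piHiQ : ℚ) : ℝ) * ((panelLeft hw (d.j + 1) : ℚ) : ℝ) := mul_le_mul_of_nonneg_right hpiHi.le hpl1
      linarith
    exact ⟨h1.trans hθ.1, hθ.2.trans h2⟩
  have hθB := θrange _ _ cBtlo cBthi
  have hθC := θrange _ _ cCtlo cCthi
  -- a tube lies in a box's s-range whenever [m⁻ − r, m⁺ + r] does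
  have srange : ∀ lo hi : ℚ, lo ≤ (d.mlo : ℚ) / tmS - ℓ.r → (d.mhi : ℚ) / tmS + ℓ.r ≤ hi →
      ∀ θ ∈ Icc a a', ∀ s ∈ Icc (mθ θ - ((ℓ.r : ℚ) : ℝ)) (mθ θ + ((ℓ.r : ℚ) : ℝ)), s ∈ Icc ((lo : ℚ) : ℝ) ((hi : ℚ) : ℝ) := by
    intro lo hi clo chi θ hθ s hs
    have c1 : ((lo : ℚ) : ℝ) ≤ (d.mlo : ℝ) / ((tmS : ℕ) : ℝ) - ((ℓ.r : ℚ) : ℝ) := by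
      have := (show ((lo : ℚ) : ℝ) ≤ ((((d.mlo : ℚ) / tmS - ℓ.r : ℚ)) : ℝ) by exact_mod_cast clo); push_cast at this; exact this
    have c2 : (d.mhi : ℝ) / ((tmS : ℕ) : ℝ) + ((ℓ.r : ℚ) : ℝ) ≤ ((hi : ℚ) : ℝ) := by
      have := (show ((((d.mhi : ℚ) / tmS + ℓ.r : ℚ)) : ℝ) ≤ ((hi : ℚ) : ℝ) by exact_mod_cast chi); push_cast at this; exact this
    obtain ⟨h1, h2⟩ := SF.m_mem θ hθ
    exact ⟨by linarith [hs.1], by linarith [hs.2]⟩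
  have htubeB := srange _ _ cBslo cBshi
  have htubeC := srange _ _ cCslo cCshi
  have hBslo0 : (0 : ℝ) ≤ (((f3Box ml.g).2.2.1 : ℚ) : ℝ) := by exact_mod_cast cBslo0
  have hBshi1 : (((f3Box ml.g).2.2.2 : ℚ) : ℝ) < 1 := by exact_mod_cast cBshi1
  have hCslo0 : (0 : ℝ) < (((gBox d.j).2.2.1 : ℚ) : ℝ) := by exact_mod_cast cCslo0
  have hCshi1 : (((gBox d.j).2.2.2 : ℚ) : ℝ) < 1 := by exact_mod_cast cCshi1
  have hmtube : ∀ θ ∈ Icc a a', mθ θ ∈ Icc (mθ θ - ((ℓ.r : ℚ) : ℝ)) (mθ θ + ((ℓ.r : ℚ) : ℝ)) :=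
    fun θ _ => ⟨by linarith [SF.hr], by linarith [SF.hr]⟩
  -- Lipschitz of F2 and of G on the tube
  have hF2lip : ∀ θ ∈ Icc a a', ∀ s ∈ Icc (mθ θ - ((ℓ.r : ℚ) : ℝ)) (mθ θ + ((ℓ.r : ℚ) : ℝ)),
      |F2field θ s - F2field θ (mθ θ)| ≤ ((M3Q : ℚ) : ℝ) * ((ℓ.r : ℚ) : ℝ) := by
    intro θ hθ s hs
    have h := F2_lipschitz_of_F3 (θ := θ) hBslo0 hBshi1 (fun x hx => F3_abs_of_f3ok hboxF (hθB θ hθ) hx) (htubeB θ hθ s hs) (htubeB θ hθ _ (hmtube θ hθ))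
    have hsm : |s - mθ θ| ≤ ((ℓ.r : ℚ) : ℝ) := abs_le.2 ⟨by linarith [hs.1], by linarith [hs.2]⟩
    exact h.trans (mul_le_mul_of_nonneg_left hsm (by norm_num [M3Q]))
  have hMG0 : (0 : ℝ) ≤ ((MGP d.j : ℚ) : ℝ) := by
    have h := Gs_abs_of_gsok1 hboxG (hθC a ⟨le_rfl, P.hab⟩) (htubeC a ⟨le_rfl, P.hab⟩ _ (hmtube a ⟨le_rfl, P.hab⟩))
    exact (abs_nonneg _).trans h
  have hGlip : ∀ θ ∈ Icc a a', ∀ s ∈ Icc (mθ θ - ((ℓ.r : ℚ) : ℝ)) (mθ θ + ((ℓ.r : ℚ) : ℝ)),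
      |Gfield θ s - Gfield θ (mθ θ)| ≤ ((MGP d.j : ℚ) : ℝ) * ((ℓ.r : ℚ) : ℝ) := by
    intro θ hθ s hs
    have h := G_lipschitz_of_Gs (θ := θ) hCslo0 hCshi1 (fun x hx => Gs_abs_of_gsok1 hboxG (hθC θ hθ) hx) (htubeC θ hθ s hs) (htubeC θ hθ _ (hmtube θ hθ))
    have hsm : |s - mθ θ| ≤ ((ℓ.r : ℚ) : ℝ) := abs_le.2 ⟨by linarith [hs.1], by linarith [hs.2]⟩
    exact h.trans (mul_le_mul_of_nonneg_left hsm hMG0)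
  -- real versions of μ, ν, Xlo, Xhi and the four envelope constants
  set μ : ℝ := (d.dlo : ℝ) / ((tmS : ℕ) : ℝ) - ((b.M : ℚ) : ℝ) * ((ℓ.r : ℚ) : ℝ) with hμ_def
  set ν : ℝ := (d.dhi : ℝ) / ((tmS : ℕ) : ℝ) + ((b.M : ℚ) : ℝ) * ((ℓ.r : ℚ) : ℝ) with hν_def
  set Xlo : ℝ := ((XaLoQ : ℚ) : ℝ) - ((b.smax : ℚ) : ℝ) with hXlo_def
  set Xhi : ℝ := ((XaHiQ : ℚ) : ℝ) + ((b.smax : ℚ) : ℝ) with hXhi_def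
  have hμ0 : 0 < μ := by
    have := (show ((0 : ℚ) : ℝ) < ((((d.dlo : ℚ) / tmS - b.M * ℓ.r : ℚ)) : ℝ) by exact_mod_cast cμ); push_cast at this; exact this
  have hXlo0 : 0 < Xlo := by
    have := (show ((0 : ℚ) : ℝ) < ((XaLoQ - b.smax : ℚ) : ℝ) by exact_mod_cast cXlo); push_cast at this; exact this
  have hEW0 : (0 : ℝ) ≤ ((ml.EW : ℚ) : ℝ) := by exact_mod_cast cEW0
  have hES0 : (0 : ℝ) ≤ ((ml.ES : ℚ) : ℝ) := by exact_mod_cast cES0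
  have hER0 : (0 : ℝ) ≤ ((ml.ER : ℚ) : ℝ) := by exact_mod_cast cER0
  have hEB0 : (0 : ℝ) ≤ ((ml.EB : ℚ) : ℝ) := by exact_mod_cast cEB0
  have hEW : envW ((XaHiQ : ℚ) : ℝ) ((ℓ.r : ℚ) : ℝ) ((b.M : ℚ) : ℝ) ((M3Q : ℚ) : ℝ) μ ν Xhi ((b.smax : ℚ) : ℝ) ≤ ((ml.EW : ℚ) : ℝ) := by
    have h := (show ((envW XaHiQ ℓ.r b.M M3Q ((d.dlo : ℚ) / tmS - b.M * ℓ.r) ((d.dhi : ℚ) / tmS + b.M * ℓ.r) (XaHiQ + b.smax) b.smax : ℚ) : ℝ)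
      ≤ ((ml.EW : ℚ) : ℝ) by exact_mod_cast cEW)
    rw [envW_cast] at h; push_cast at h; exact h
  have hES : envS ((ℓ.r : ℚ) : ℝ) ((b.M : ℚ) : ℝ) ((MGP d.j : ℚ) : ℝ) μ Xhi ((b.smax : ℚ) : ℝ) ≤ ((ml.ES : ℚ) : ℝ) := by
    have h := (show ((envS ℓ.r b.M (MGP d.j) ((d.dlo : ℚ) / tmS - b.M * ℓ.r) (XaHiQ + b.smax) b.smax : ℚ) : ℝ) ≤ ((ml.ES : ℚ) : ℝ) by exact_mod_cast cES)
    rw [envS_cast] at h; push_cast at h; exact h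
  have hER : envR ((ℓ.r : ℚ) : ℝ) ((b.M : ℚ) : ℝ) ((MGP d.j : ℚ) : ℝ) μ Xhi ((b.smax : ℚ) : ℝ) ≤ ((ml.ER : ℚ) : ℝ) := by
    have h := (show ((envR ℓ.r b.M (MGP d.j) ((d.dlo : ℚ) / tmS - b.M * ℓ.r) (XaHiQ + b.smax) b.smax : ℚ) : ℝ) ≤ ((ml.ER : ℚ) : ℝ) by exact_mod_cast cER)
    rw [envR_cast] at h; push_cast at h; exact h
  have hEB : envB ((ℓ.r : ℚ) : ℝ) ((b.M : ℚ) : ℝ) ((MGP d.j : ℚ) : ℝ) μ Xlo ((b.smax : ℚ) : ℝ) ≤ ((ml.EB : ℚ) : ℝ) := by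
    have h := (show ((envB ℓ.r b.M (MGP d.j) ((d.dlo : ℚ) / tmS - b.M * ℓ.r) (XaLoQ - b.smax) b.smax : ℚ) : ℝ) ≤ ((ml.EB : ℚ) : ℝ) by exact_mod_cast cEB)
    rw [envB_cast] at h; push_cast at h; exact h
  -- the common per-point facts on the tube
  have common : ∀ θ ∈ Icc a a', ∀ s ∈ Icc (mθ θ - ((ℓ.r : ℚ) : ℝ)) (mθ θ + ((ℓ.r : ℚ) : ℝ)),
      |s - mθ θ| ≤ ((ℓ.r : ℚ) : ℝ)
      ∧ |(Xa + s * Real.cos θ) - (Xa + mθ θ * Real.cos θ)| ≤ ((ℓ.r : ℚ) : ℝ)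
      ∧ |Dfield θ s - Dfield θ (mθ θ)| ≤ ((b.M : ℚ) : ℝ) * ((ℓ.r : ℚ) : ℝ)
      ∧ (μ ≤ Dfield θ s ∧ Dfield θ s ≤ ν) ∧ (μ ≤ Dfield θ (mθ θ) ∧ Dfield θ (mθ θ) ≤ ν)
      ∧ (Xlo ≤ Xa + s * Real.cos θ ∧ Xa + s * Real.cos θ ≤ Xhi) ∧ (Xlo ≤ Xa + mθ θ * Real.cos θ ∧ Xa + mθ θ * Real.cos θ ≤ Xhi)
      ∧ (0 ≤ s ∧ s ≤ ((b.smax : ℚ) : ℝ)) ∧ (0 ≤ mθ θ ∧ mθ θ ≤ ((b.smax : ℚ) : ℝ))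
      ∧ |F2field θ s| ≤ ((b.M : ℚ) : ℝ) ∧ |F2field θ (mθ θ)| ≤ ((b.M : ℚ) : ℝ)
      ∧ μ ^ 2 ≤ Gfield θ s ∧ μ ^ 2 ≤ Gfield θ (mθ θ)
      ∧ |2 * s * Real.cos θ - 2 * mθ θ * Real.cos θ| ≤ 2 * ((ℓ.r : ℚ) : ℝ) := by
    intro θ hθ s hs
    have hsS := SF.tube_sub hθ hs
    have hmS := SF.m_sub hθ
    obtain ⟨hDd, hDlo, hDhi⟩ := SF.tube_D hθ hs
    obtain ⟨hDm1, hDm2⟩ := SF.D_m θ hθ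
    have hMr : 0 ≤ ((b.M : ℚ) : ℝ) * ((ℓ.r : ℚ) : ℝ) := mul_nonneg SF.hM SF.hr.le
    have hRs := SF.strip_R (θ := θ) hsS
    have hRm := SF.strip_R (θ := θ) hmS
    have hsm : |s - mθ θ| ≤ ((ℓ.r : ℚ) : ℝ) := abs_le.2 ⟨by linarith [hs.1], by linarith [hs.2]⟩
    have hμs : μ ≤ Dfield θ s := hDlo
    have hμm : μ ≤ Dfield θ (mθ θ) := by linarith
    have hGs : μ ^ 2 ≤ Gfield θ s := (pow_le_pow_left₀ hμ0.le hμs 2).trans (Dfield_sq_le_Gfield θ s)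
    have hGm : μ ^ 2 ≤ Gfield θ (mθ θ) := (pow_le_pow_left₀ hμ0.le hμm 2).trans (Dfield_sq_le_Gfield θ (mθ θ))
    have hcs : |2 * s * Real.cos θ - 2 * mθ θ * Real.cos θ| ≤ 2 * ((ℓ.r : ℚ) : ℝ) := by
      rw [show 2 * s * Real.cos θ - 2 * mθ θ * Real.cos θ = 2 * ((s - mθ θ) * Real.cos θ) by ring, abs_mul, abs_two]
      have := mul_le_of_le_one_right (abs_nonneg (s - mθ θ)) (Real.abs_cos_le_one θ)
      rw [abs_mul]
      linarith
    exact ⟨hsm, (StripFacts.R_sub_abs θ s (mθ θ)).trans hsm, hDd, ⟨hDlo, hDhi⟩, ⟨hμm, by linarith⟩,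
      ⟨by linarith [hRs.1], by linarith [hRs.2]⟩, ⟨by linarith [hRm.1], by linarith [hRm.2]⟩,
      ⟨SF.hsA.le.trans hsS.1, hsS.2⟩, ⟨SF.hsA.le.trans hmS.1, hmS.2⟩, SF.F2_abs θ hθ s hsS, SF.F2_abs θ hθ _ hmS, hGs, hGm, hcs⟩
  -- the four envelopes on the tube
  have hEWt : ∀ θ ∈ Icc a a', ∀ s ∈ Icc (mθ θ - ((ℓ.r : ℚ) : ℝ)) (mθ θ + ((ℓ.r : ℚ) : ℝ)), |KW θ s - KW θ (mθ θ)| ≤ ((ml.EW : ℚ) : ℝ) := by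
    intro θ hθ s hs
    obtain ⟨hsm, hR, hDd, hDs, hDm, hRs, hRm, hs01, hm01, hFs, hFm, hGs, hGm, hcs⟩ := common θ hθ s hs
    have hDs0 : Dfield θ s ≠ 0 := (hμ0.trans_le hDs.1).ne'
    have hDm0 : Dfield θ (mθ θ) ≠ 0 := (hμ0.trans_le hDm.1).ne'
    rw [KW_eq hDs0, KW_eq hDm0]
    exact (envW_bound hXa0 hXaHi hμ0 hXlo0 hsm hR hDd (hF2lip θ hθ s hs) (hGlip θ hθ s hs) hDs hDm hRs hRm hs01 hm01 hFs hFm hGs hGm hcs).trans hEW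
  have hESt : ∀ θ ∈ Icc a a', ∀ s ∈ Icc (mθ θ - ((ℓ.r : ℚ) : ℝ)) (mθ θ + ((ℓ.r : ℚ) : ℝ)), |KS θ s - KS θ (mθ θ)| ≤ ((ml.ES : ℚ) : ℝ) := by
    intro θ hθ s hs
    obtain ⟨hsm, hR, hDd, hDs, hDm, hRs, hRm, hs01, hm01, -, -, hGs, hGm, -⟩ := common θ hθ s hs
    have hDs0 : Dfield θ s ≠ 0 := (hμ0.trans_le hDs.1).ne'
    have hDm0 : Dfield θ (mθ θ) ≠ 0 := (hμ0.trans_le hDm.1).ne'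
    have hGs0 : Gfield θ s ≠ 0 := ((pow_pos hμ0 2).trans_le hGs).ne'
    have hGm0 : Gfield θ (mθ θ) ≠ 0 := ((pow_pos hμ0 2).trans_le hGm).ne'
    rw [KS_eq hDs0 hGs0, KS_eq hDm0 hGm0]
    exact (envS_bound hμ0 hXlo0 hsm hR hDd (hGlip θ hθ s hs) hDs hDm hRs hRm hs01 hm01 hGs hGm).trans hES
  have hERt : ∀ θ ∈ Icc a a', ∀ s ∈ Icc (mθ θ - ((ℓ.r : ℚ) : ℝ)) (mθ θ + ((ℓ.r : ℚ) : ℝ)), |KR θ s - KR θ (mθ θ)| ≤ ((ml.ER : ℚ) : ℝ) := by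
    intro θ hθ s hs
    obtain ⟨hsm, hR, hDd, hDs, hDm, hRs, hRm, hs01, hm01, -, -, hGs, hGm, -⟩ := common θ hθ s hs
    have hDs0 : Dfield θ s ≠ 0 := (hμ0.trans_le hDs.1).ne'
    have hDm0 : Dfield θ (mθ θ) ≠ 0 := (hμ0.trans_le hDm.1).ne'
    have hGs0 : Gfield θ s ≠ 0 := ((pow_pos hμ0 2).trans_le hGs).ne'
    have hGm0 : Gfield θ (mθ θ) ≠ 0 := ((pow_pos hμ0 2).trans_le hGm).ne'
    rw [KR_eq hDs0 hGs0, KR_eq hDm0 hGm0]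
    exact (envR_bound hμ0 hXlo0 hsm hR hDd (hGlip θ hθ s hs) hDs hDm hRs hRm hs01 hm01 hGs hGm).trans hER
  have hEBt : ∀ θ ∈ Icc a a', ∀ s ∈ Icc (mθ θ - ((ℓ.r : ℚ) : ℝ)) (mθ θ + ((ℓ.r : ℚ) : ℝ)), |KB θ s - KB θ (mθ θ)| ≤ ((ml.EB : ℚ) : ℝ) := by
    intro θ hθ s hs
    obtain ⟨hsm, hR, hDd, hDs, hDm, hRs, hRm, hs01, hm01, -, -, hGs, hGm, -⟩ := common θ hθ s hs
    have hDs0 : Dfield θ s ≠ 0 := (hμ0.trans_le hDs.1).ne'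
    have hDm0 : Dfield θ (mθ θ) ≠ 0 := (hμ0.trans_le hDm.1).ne'
    have hGs0 : Gfield θ s ≠ 0 := ((pow_pos hμ0 2).trans_le hGs).ne'
    have hGm0 : Gfield θ (mθ θ) ≠ 0 := ((pow_pos hμ0 2).trans_le hGm).ne'
    have hXs0 : Xa + s * Real.cos θ ≠ 0 := (hXlo0.trans_le hRs.1).ne'
    have hXm0 : Xa + mθ θ * Real.cos θ ≠ 0 := (hXlo0.trans_le hRm.1).ne'
    rw [KB_eq hXs0 hDs0 hGs0, KB_eq hXm0 hDm0 hGm0]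
    exact (envB_bound hμ0 hXlo0 hsm hR hDd (hGlip θ hθ s hs) hDs hDm hRs hRm hs01 hm01 hGs hGm).trans hEB
  -- continuity of the kernels on the box
  set Bx := Icc a a' ×ˢ Icc ((b.sA : ℚ) : ℝ) ((b.smax : ℚ) : ℝ) with hBx
  have hD0 : ∀ p ∈ Bx, Dfield p.1 p.2 ≠ 0 := fun p hp => (P.slopePos p.1 hp.1 p.2 hp.2).ne'
  have hR0 : ∀ p ∈ Bx, Xa + p.2 * Real.cos p.1 ≠ 0 := fun p hp => (SF.strip_X_pos (θ := p.1) hp.2).ne'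
  have hF2c : ContinuousOn (fun p : ℝ × ℝ => F2field p.1 p.2) Bx := continuousOn_F2field_box SF.hsA.le SF.hsmax
  have hGc : ContinuousOn (fun p : ℝ × ℝ => Gfield p.1 p.2) Bx := continuousOn_Gfield_box' SF.hsA SF.hsmax
  have hG0 : ∀ p ∈ Bx, Gfield p.1 p.2 ≠ 0 := fun p hp =>
    ((pow_pos (P.slopePos p.1 hp.1 p.2 hp.2) 2).trans_le (Dfield_sq_le_Gfield p.1 p.2)).ne'
  have hRc : ContinuousOn (fun p : ℝ × ℝ => (Xa + p.2 * Real.cos p.1) ^ 2) Bx := by fun_prop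
  have hKWc : ContinuousOn (fun p : ℝ × ℝ => KW p.1 p.2) Bx := (continuousOn_volKernelDs P.slopeCont hF2c hD0).div P.slopeCont hD0
  have hKSc : ContinuousOn (fun p : ℝ × ℝ => KS p.1 p.2) Bx := continuousOn_invGradKernel P.slopeCont hGc hD0 hG0
  have hKRc : ContinuousOn (fun p : ℝ × ℝ => KR p.1 p.2) Bx :=
    (hRc.mul (continuousOn_volKernel P.slopeCont hD0)).div hGc hG0
  have hKBc : ContinuousOn (fun p : ℝ × ℝ => KB p.1 p.2) Bx :=
    (continuousOn_volKernel P.slopeCont hD0).div (hRc.mul hGc) fun p hp => mul_ne_zero (pow_ne_zero 2 (hR0 p hp)) (hG0 p hp)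
  -- model-7's register segments (the Mercier certificate)
  have hsc' := QHalfMerc.sound_of_ok hmc
  rw [cmj] at hsc'
  obtain ⟨hsW, hsS, hsR, hsB⟩ := hsc'
  -- the register functions agree with the kernels along the approximant on the t-panel
  have tfacts : ∀ t ∈ Icc ((panelLeft hw d.j : ℚ) : ℝ) ((panelLeft hw (d.j + 1) : ℚ) : ℝ),
      Real.pi * t ∈ Icc a a' ∧ mθ (Real.pi * t) = mA t ∧ QHalfMerc.XA t ≠ 0 ∧ DrA t ≠ 0 ∧ QHalfMerc.GA t ≠ 0 := by
    intro t ht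
    have hθ : Real.pi * t ∈ Icc a a' := ⟨mul_le_mul_of_nonneg_left ht.1 hpi.le, mul_le_mul_of_nonneg_left ht.2 hpi.le⟩
    have hmt : mθ (Real.pi * t) = mA t := by unfold mθ; rw [mul_div_cancel_left₀ t hpi.ne']
    obtain ⟨-, -, -, -, hDm, -, hRm, -, -, -, -, -, hGm, -⟩ := common _ hθ _ (hmtube _ hθ)
    rw [hmt] at hDm hRm hGm
    refine ⟨hθ, hmt, ?_, ?_, ?_⟩
    · show Xa + mA t * Real.cos (Real.pi * t) ≠ 0; exact (hXlo0.trans_le hRm.1).ne'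
    · show Dfield (Real.pi * t) (mA t) ≠ 0; exact (hμ0.trans_le hDm.1).ne'
    · show Gfield (Real.pi * t) (mA t) ≠ 0; exact ((pow_pos hμ0 2).trans_le hGm).ne'
  have hgW : ∀ t ∈ Icc ((panelLeft hw d.j : ℚ) : ℝ) ((panelLeft hw (d.j + 1) : ℚ) : ℝ), QHalfMerc.gWA t = KW (Real.pi * t) (mθ (Real.pi * t)) * Real.pi := by
    intro t ht; obtain ⟨-, hmt, hX, hD, -⟩ := tfacts t ht; rw [hmt]; exact gWA_eq hX hD
  have hgS : ∀ t ∈ Icc ((panelLeft hw d.j : ℚ) : ℝ) ((panelLeft hw (d.j + 1) : ℚ) : ℝ), QHalfMerc.gAsA t = KS (Real.pi * t) (mθ (Real.pi * t)) * Real.pi := by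
    intro t ht; obtain ⟨-, hmt, hX, hD, hG⟩ := tfacts t ht; rw [hmt]; exact gAsA_eq hX hD hG
  have hgR : ∀ t ∈ Icc ((panelLeft hw d.j : ℚ) : ℝ) ((panelLeft hw (d.j + 1) : ℚ) : ℝ), QHalfMerc.gARA t = KR (Real.pi * t) (mθ (Real.pi * t)) * Real.pi := by
    intro t ht; obtain ⟨-, hmt, hX, hD, hG⟩ := tfacts t ht; rw [hmt]; exact gARA_eq hX hD hG
  have hgB : ∀ t ∈ Icc ((panelLeft hw d.j : ℚ) : ℝ) ((panelLeft hw (d.j + 1) : ℚ) : ℝ), QHalfMerc.gB1A t = KB (Real.pi * t) (mθ (Real.pi * t)) * Real.pi := by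
    intro t ht; obtain ⟨-, hmt, hX, hD, hG⟩ := tfacts t ht; rw [hmt]; exact gB1A_eq hX hD hG
  -- brackets in ℝ
  have cW1 : ((ml.WLo : ℚ) : ℝ) ≤ (mc.wlo : ℝ) / ((tmS : ℕ) : ℝ) - ((ml.EW : ℚ) : ℝ) * (((piHiQ : ℚ) : ℝ) / 32) := by
    have := (show ((ml.WLo : ℚ) : ℝ) ≤ ((((mc.wlo : ℚ) / tmS - ml.EW * (piHiQ / 32) : ℚ)) : ℝ) by exact_mod_cast cWLo); push_cast at this; exact this
  have cW2 : (mc.whi : ℝ) / ((tmS : ℕ) : ℝ) + ((ml.EW : ℚ) : ℝ) * (((piHiQ : ℚ) : ℝ) / 32) ≤ ((ml.WHi : ℚ) : ℝ) := by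
    have := (show ((((mc.whi : ℚ) / tmS + ml.EW * (piHiQ / 32) : ℚ)) : ℝ) ≤ ((ml.WHi : ℚ) : ℝ) by exact_mod_cast cWHi); push_cast at this; exact this
  have cS1 : ((ml.SLo : ℚ) : ℝ) ≤ (mc.slo : ℝ) / ((tmS : ℕ) : ℝ) - ((ml.ES : ℚ) : ℝ) * (((piHiQ : ℚ) : ℝ) / 32) := by
    have := (show ((ml.SLo : ℚ) : ℝ) ≤ ((((mc.slo : ℚ) / tmS - ml.ES * (piHiQ / 32) : ℚ)) : ℝ) by exact_mod_cast cSLo); push_cast at this; exact this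
  have cS2 : (mc.shi : ℝ) / ((tmS : ℕ) : ℝ) + ((ml.ES : ℚ) : ℝ) * (((piHiQ : ℚ) : ℝ) / 32) ≤ ((ml.SHi : ℚ) : ℝ) := by
    have := (show ((((mc.shi : ℚ) / tmS + ml.ES * (piHiQ / 32) : ℚ)) : ℝ) ≤ ((ml.SHi : ℚ) : ℝ) by exact_mod_cast cSHi); push_cast at this; exact this
  have cR1 : ((ml.RLo : ℚ) : ℝ) ≤ (mc.rlo : ℝ) / ((tmS : ℕ) : ℝ) - ((ml.ER : ℚ) : ℝ) * (((piHiQ : ℚ) : ℝ) / 32) := by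
    have := (show ((ml.RLo : ℚ) : ℝ) ≤ ((((mc.rlo : ℚ) / tmS - ml.ER * (piHiQ / 32) : ℚ)) : ℝ) by exact_mod_cast cRLo); push_cast at this; exact this
  have cR2 : (mc.rhi : ℝ) / ((tmS : ℕ) : ℝ) + ((ml.ER : ℚ) : ℝ) * (((piHiQ : ℚ) : ℝ) / 32) ≤ ((ml.RHi : ℚ) : ℝ) := by
    have := (show ((((mc.rhi : ℚ) / tmS + ml.ER * (piHiQ / 32) : ℚ)) : ℝ) ≤ ((ml.RHi : ℚ) : ℝ) by exact_mod_cast cRHi); push_cast at this; exact this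
  have cB1 : ((ml.BLo : ℚ) : ℝ) ≤ (mc.blo : ℝ) / ((tmS : ℕ) : ℝ) - ((ml.EB : ℚ) : ℝ) * (((piHiQ : ℚ) : ℝ) / 32) := by
    have := (show ((ml.BLo : ℚ) : ℝ) ≤ ((((mc.blo : ℚ) / tmS - ml.EB * (piHiQ / 32) : ℚ)) : ℝ) by exact_mod_cast cBLo); push_cast at this; exact this
  have cB2 : (mc.bhi : ℝ) / ((tmS : ℕ) : ℝ) + ((ml.EB : ℚ) : ℝ) * (((piHiQ : ℚ) : ℝ) / 32) ≤ ((ml.BHi : ℚ) : ℝ) := by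
    have := (show ((((mc.bhi : ℚ) / tmS + ml.EB * (piHiQ / 32) : ℚ)) : ℝ) ≤ ((ml.BHi : ℚ) : ℝ) by exact_mod_cast cBHi); push_cast at this; exact this
  exact ⟨tube_link P SF ha_def ha'_def hKWc hsW hgW hEW0 hEWt cW1 cW2, tube_link P SF ha_def ha'_def hKSc hsS hgS hES0 hESt cS1 cS2,
    tube_link P SF ha_def ha'_def hKRc hsR hgR hER0 hERt cR1 cR2, tube_link P SF ha_def ha'_def hKBc hsB hgB hEB0 hEBt cB1 cB2⟩

end panel

end Summit.Ventures.FusionMHD.Models.CFIterLike.QHalf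

end
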